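/-
COR-CM (cell pub-hodgecm2, stage 2 of the Hodge ladder) — count-neutral KERNEL COMBINATORICS «field level of the ORDER-16 DISPATCH: every Galois CM field of
degree 16 — hence every Galois CM field of degree < 32, and of degree < 64 other than 32 and 48 — has EXACTLY φ₂(F) generating faces, no hypothesis on
the group» (seat prover-pub-hodgecm2-b23-g55-0, binder prover b23, gen 55; claim HOME/INBOX.md l.25631, NAME ASK ibid. — stem `CorCM/FaceOrderSixteen*`).
Theorems only; `Census/OrderSixteenLaw.lean` (this seat), the field transfer `CorCM/FaceGenerationTransfer.lean`, the small-degree ∕ Sylow-transfer ∕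
binary-tetrahedral field files and the INT2-GEN socket are used BY NAME; nothing asserted.  `Interfaces.lean` (C1), every E term, B01, `Transposition/*`,
`PortJoin/*`, `D2Bridge/*` untouched.
HONEST FRAMING: `HC_CM` is NOT proved, here or anywhere in the tree; this file produces no period and proves no face period for any field; §2 is CONDITIONAL
on the face periods exactly as the earlier sockets.
T5: n/a-class (hypothesis binders: `[F:ℚ] = 16` — inhabited by every Galois CM field of degree 16, e.g. `ℚ(ζ₁₇)`, `ℚ(ζ₃₂)`, the `D₄ × ℤ/2`-,
`Q₈ × ℤ/2`-, Pauli-, `ℤ/4 ⋊ ℤ/4`-, `G(16,3)`-fields; resp. `[F:ℚ] < 32`, `[F:ℚ] < 64 ∧ ≠ 32, 48`; checker: self, 2026-08-26).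
-/
import Summits.HodgeConjecture.CorCM.Census.OrderSixteenLaw
import Summits.HodgeConjecture.CorCM.FaceBinaryTetrahedral
import HarnessLib

/-!
# Field level of the order-16 dispatch: every Galois CM field of degree `16`, every Galois CM field of degree `< 32`

**`isLeast_card_faces_hgen_of_finrank_eq_sixteen`**: a Galois CM field `F` of degree `16` (Galois group ANY of the fourteen groups of order `16`,
complex conjugation ANY central involution) has EXACTLY `φ₂(F)` generating faces — `σ₀` and the degree only (`Census/OrderSixteenLaw`: the
classification-free order-`16` dispatch).  Hence **`isLeast_card_faces_hgen_of_finrank_lt_thirtyTwo`**: EVERY Galois CM field of degree `< 32`, and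
**`isLeast_card_faces_hgen_of_finrank_lt_sixtyFour`**: every Galois CM field of degree `< 64` other than `32` and `48` (seat b23 gen 50ʼs `< 24`,
gen 51ʼs `8 ∤ [F:ℚ]`, gen 53ʼs `24` and `8p`, and this file's `16`); also every degree `2ᵏ ≤ 16` (`isLeast_card_faces_hgen_of_finrank_two_pow_le_sixteen`).
§2: the CONDITIONAL Hodge-conjecture readings through the INT2-GEN socket.  `HC_CM` is NOT proved.

## References
* [Pohlmann1968] H. Pohlmann, Algebraic cycles on abelian varieties of complex multiplication type, Ann. of Math. 88 (1968), Thm 1.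
* [Shimura1998] G. Shimura, Abelian Varieties with Complex Multiplication and Modular Functions, §6.2 Thm. 3, §8.1.
-/

noncomputable section

open CategoryTheory NumberField NumberField.ComplexEmbedding
open Literature.AlgebraicGeometry Literature.AlgebraicGeometry.Motives Literature.AlgebraicGeometry.HodgeTheory
open Literature.AlgebraicGeometry.ComplexMultiplication Literature.AlgebraicGeometry.Milne1999
open Literature.NumberTheory.Automorphic
open Literature.NumberTheory.Automorphic.PicardCM
open Summit.HodgeConjecture.CorCM.Domination

namespace Summit.HodgeConjecture.CorCM.FaceOrderSixteen

open Summit.HodgeConjecture.CorCM.Prior.AllgGroup.RfwfAllgGroup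
open Summit.HodgeConjecture.CorCM.Census.BlockParity
open Summit.HodgeConjecture.CorCM.Census.Coinvariant
open Summit.HodgeConjecture.CorCM.Census

section Field

variable {F : Type} [Field F] [NumberField F]

/-! ## §1 Exactly `φ₂(F)` generating faces -/

/-- **EVERY GALOIS CM FIELD OF DEGREE `16` HAS EXACTLY `φ₂(F)` GENERATING FACES** — no hypothesis on the Galois group or on complex conjugation
(the fourteen groups of order `16`; the order-16 dispatch). [folklore] -/
theorem isLeast_card_faces_hgen_of_finrank_eq_sixteen [IsCMField F] [IsGalois ℚ F] (hdeg : Module.finrank ℚ F = 16) (σ₀ : F →+* ℂ) :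
    IsLeast {n : ℕ | ∃ 𝒮 : Finset (Face F), 𝒮.card = n ∧
      ∀ f : Face F, lefChar f.corner (fun _ => ({σ₀} : Finset (F →+* ℂ))) ∈ AddSubgroup.closure
        {a : Asym F | ∃ g ∈ (𝒮 : Set (Face F)), ∃ σ : F →+* ℂ, a = lefChar g.corner (fun _ => ({σ} : Finset (F →+* ℂ)))}}
      (fibreTwo (conjT : GalT F) conjT_mul_self) := by
  refine FaceTransfer.isLeast_card_faces_hgen_of_intrinsic _ ?_ (fun S₀ hS₀ hS => ?_) σ₀
  · obtain ⟨S, hS, hcard, hgen⟩ := (OrderSixteen.isLeast_card_gfaces_generate_fibreTwo_of_card_eq_sixteen conjT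
      ((FaceCensus.card_galT (F := F)).trans hdeg) conjT_mul_self conjT_ne_one FaceBasis.conjT_comm).1
    exact ⟨S, hS, hcard.le, hgen⟩
  · exact fibreTwo_le_card conjT conjT_mul_self FaceBasis.conjT_comm S₀ (Submodule.span ℤ (pairSet conjT)) le_rfl hS₀
      (fun y hy => hS (gfaceSet_subset_hodgeSpan conjT conjT_mul_self hy))

/-- **EVERY GALOIS CM FIELD OF DEGREE `< 64` OTHER THAN `32` AND `48` HAS EXACTLY `φ₂(F)` GENERATING FACES** — seat b23 gen 53ʼs
`FaceBinaryTetrahedral.isLeast_card_faces_hgen_of_finrank_lt_sixtyFour'` with the row `16` supplied by the order-16 dispatch; NO hypothesis on the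
Galois group. [folklore] -/
theorem isLeast_card_faces_hgen_of_finrank_lt_sixtyFour [IsCMField F] [IsGalois ℚ F] (h64 : Module.finrank ℚ F < 64)
    (h32 : Module.finrank ℚ F ≠ 32) (h48 : Module.finrank ℚ F ≠ 48) (σ₀ : F →+* ℂ) :
    IsLeast {n : ℕ | ∃ 𝒮 : Finset (Face F), 𝒮.card = n ∧
      ∀ f : Face F, lefChar f.corner (fun _ => ({σ₀} : Finset (F →+* ℂ))) ∈ AddSubgroup.closure
        {a : Asym F | ∃ g ∈ (𝒮 : Set (Face F)), ∃ σ : F →+* ℂ, a = lefChar g.corner (fun _ => ({σ} : Finset (F →+* ℂ)))}}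
      (fibreTwo (conjT : GalT F) conjT_mul_self) := by
  by_cases h16 : Module.finrank ℚ F = 16
  · exact isLeast_card_faces_hgen_of_finrank_eq_sixteen h16 σ₀
  · exact FaceBinaryTetrahedral.isLeast_card_faces_hgen_of_finrank_lt_sixtyFour' h64 h16 h32 h48 σ₀

/-- **EVERY GALOIS CM FIELD OF DEGREE `< 32` HAS EXACTLY `φ₂(F)` GENERATING FACES** — no hypothesis on the Galois group; the first open degree
is now `32`. [folklore] -/
theorem isLeast_card_faces_hgen_of_finrank_lt_thirtyTwo [IsCMField F] [IsGalois ℚ F] (h32 : Module.finrank ℚ F < 32) (σ₀ : F →+* ℂ) :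
    IsLeast {n : ℕ | ∃ 𝒮 : Finset (Face F), 𝒮.card = n ∧
      ∀ f : Face F, lefChar f.corner (fun _ => ({σ₀} : Finset (F →+* ℂ))) ∈ AddSubgroup.closure
        {a : Asym F | ∃ g ∈ (𝒮 : Set (Face F)), ∃ σ : F →+* ℂ, a = lefChar g.corner (fun _ => ({σ} : Finset (F →+* ℂ)))}}
      (fibreTwo (conjT : GalT F) conjT_mul_self) :=
  isLeast_card_faces_hgen_of_finrank_lt_sixtyFour (by omega) (by omega) (by omega) σ₀

/-- **EVERY GALOIS CM FIELD OF DEGREE `2ᵏ ≤ 16` HAS EXACTLY `φ₂(F)` GENERATING FACES** (seat b23 gen 50ʼs `2ᵏ ≤ 8` and the row `16`). [folklore] -/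
theorem isLeast_card_faces_hgen_of_finrank_two_pow_le_sixteen [IsCMField F] [IsGalois ℚ F] {k : ℕ} (hdeg : Module.finrank ℚ F = 2 ^ k)
    (hk : k ≤ 4) (σ₀ : F →+* ℂ) :
    IsLeast {n : ℕ | ∃ 𝒮 : Finset (Face F), 𝒮.card = n ∧
      ∀ f : Face F, lefChar f.corner (fun _ => ({σ₀} : Finset (F →+* ℂ))) ∈ AddSubgroup.closure
        {a : Asym F | ∃ g ∈ (𝒮 : Set (Face F)), ∃ σ : F →+* ℂ, a = lefChar g.corner (fun _ => ({σ} : Finset (F →+* ℂ)))}}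
      (fibreTwo (conjT : GalT F) conjT_mul_self) := by
  by_cases h4 : k = 4
  · subst h4
    exact isLeast_card_faces_hgen_of_finrank_eq_sixteen (by rw [hdeg]; norm_num) σ₀
  · exact FaceIndexTwoCyclic.isLeast_card_faces_hgen_of_finrank_two_pow_le_eight hdeg (by omega) σ₀

end Field

/-! ## §2 The conditional Hodge-conjecture readings -/

/-- **HC for the slice of a Galois CM field of degree `16`, from `φ₂(K)` face periods** (CONDITIONAL; `HC_CM` is NOT proved; no hypothesis on the Galois
group). [cite: Shimura1998, §6.2 Theorem 3 and §6.1 Corollary of Theorem 2 (pp. 41–43)] [cite: Pohlmann1968, Thm. 1]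
[cite: Milne1999LefschetzClasses, Thm. 3.2 and Cor. 4.5] [cite: MumfordAV1970, §19 Thm. 1 and p. 169] -/
theorem hodgeConjectureFor_of_finrank_eq_sixteen_of_exists_facePeriod (K : CMField) [hGal : IsGalois ℚ K] (σ₀ : (K : Type) →+* ℂ)
    (hdeg : Module.finrank ℚ K = 16) :
    ∃ 𝒮 : Finset (Face K), 𝒮.card = fibreTwo (conjT : GalT K) conjT_mul_self ∧
      ((∀ f ∈ 𝒮, ∃ ι₁ : K →+* ℂ, f.Admissible ι₁ ∧ ∃ (V : HermSpace3 K ι₁) (σ : K →+* ℂ),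
        (Model.picardCMUniverse exists_isReal_hodgeModel_holds hodgePQ_independent_of_hodgeModel_holds
          BallQuotient.ballQuotientUniformised_holds cmAbelianVarietyRealised_holds).PeriodNV ι₁ V K f.psi σ) →
      ∀ {P B : AbelianVariety ℂ}, AbelianVariety.IsProductOf (fun B : AbelianVariety ℂ =>
        ∃ (E : Type) (_ : Field E) (_ : NumberField E) (_ : IsCMField E) (_ : E →+* (K : Type)) (Φ : CMType E)
          (ι : 𝓞 E →+* End B) (ϑ : E →+* Module.End ℂ (complexBetti B.X 1)),
          IsCMTypeRealisation Φ B ι ϑ) P →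
      AVDominatedBy B P → HodgeConjectureFor B.dim B.X) := by
  obtain ⟨⟨𝒮, hcard, hgen⟩, -⟩ := isLeast_card_faces_hgen_of_finrank_eq_sixteen (F := K) hdeg σ₀
  refine ⟨𝒮, hcard, fun h P B hP hB => ?_⟩
  have h6 : 6 ≤ Module.finrank ℚ K := by rw [hdeg]; omega
  exact hodgeConjectureFor_of_avDominatedBy_isProductOf_of_exists_facePeriod_on K h6 (𝒮 : Set (Face K)) σ₀ hgen
    (fun f hf => h f (Finset.mem_coe.mp hf)) hP hB

/-- **HC for the slice of a Galois CM field of degree `6 ≤ [K:ℚ] < 32`, from `φ₂(K)` face periods** (CONDITIONAL; `HC_CM` is NOT proved; no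
hypothesis on the Galois group). [cite: Shimura1998, §6.2 Theorem 3 and §6.1 Corollary of Theorem 2 (pp. 41–43)] [cite: Pohlmann1968, Thm. 1]
[cite: Milne1999LefschetzClasses, Thm. 3.2 and Cor. 4.5] [cite: MumfordAV1970, §19 Thm. 1 and p. 169] -/
theorem hodgeConjectureFor_of_finrank_lt_thirtyTwo_of_exists_facePeriod (K : CMField) [hGal : IsGalois ℚ K] (σ₀ : (K : Type) →+* ℂ)
    (h6 : 6 ≤ Module.finrank ℚ K) (h32 : Module.finrank ℚ K < 32) :
    ∃ 𝒮 : Finset (Face K), 𝒮.card = fibreTwo (conjT : GalT K) conjT_mul_self ∧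
      ((∀ f ∈ 𝒮, ∃ ι₁ : K →+* ℂ, f.Admissible ι₁ ∧ ∃ (V : HermSpace3 K ι₁) (σ : K →+* ℂ),
        (Model.picardCMUniverse exists_isReal_hodgeModel_holds hodgePQ_independent_of_hodgeModel_holds
          BallQuotient.ballQuotientUniformised_holds cmAbelianVarietyRealised_holds).PeriodNV ι₁ V K f.psi σ) →
      ∀ {P B : AbelianVariety ℂ}, AbelianVariety.IsProductOf (fun B : AbelianVariety ℂ =>
        ∃ (E : Type) (_ : Field E) (_ : NumberField E) (_ : IsCMField E) (_ : E →+* (K : Type)) (Φ : CMType E)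
          (ι : 𝓞 E →+* End B) (ϑ : E →+* Module.End ℂ (complexBetti B.X 1)),
          IsCMTypeRealisation Φ B ι ϑ) P →
      AVDominatedBy B P → HodgeConjectureFor B.dim B.X) := by
  obtain ⟨⟨𝒮, hcard, hgen⟩, -⟩ := isLeast_card_faces_hgen_of_finrank_lt_thirtyTwo (F := K) h32 σ₀
  refine ⟨𝒮, hcard, fun h P B hP hB => ?_⟩
  exact hodgeConjectureFor_of_avDominatedBy_isProductOf_of_exists_facePeriod_on K h6 (𝒮 : Set (Face K)) σ₀ hgen
    (fun f hf => h f (Finset.mem_coe.mp hf)) hP hB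

/-- **HC for the slice of a Galois CM field of degree `6 ≤ [K:ℚ] < 64`, `[K:ℚ] ≠ 32, 48`, from `φ₂(K)` face periods** (CONDITIONAL; `HC_CM` is NOT
proved; no hypothesis on the Galois group). [cite: Shimura1998, §6.2 Theorem 3 and §6.1 Corollary of Theorem 2 (pp. 41–43)] [cite: Pohlmann1968, Thm. 1]
[cite: Milne1999LefschetzClasses, Thm. 3.2 and Cor. 4.5] [cite: MumfordAV1970, §19 Thm. 1 and p. 169] -/
theorem hodgeConjectureFor_of_finrank_lt_sixtyFour_of_exists_facePeriod (K : CMField) [hGal : IsGalois ℚ K] (σ₀ : (K : Type) →+* ℂ)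
    (h6 : 6 ≤ Module.finrank ℚ K) (h64 : Module.finrank ℚ K < 64) (h32 : Module.finrank ℚ K ≠ 32) (h48 : Module.finrank ℚ K ≠ 48) :
    ∃ 𝒮 : Finset (Face K), 𝒮.card = fibreTwo (conjT : GalT K) conjT_mul_self ∧
      ((∀ f ∈ 𝒮, ∃ ι₁ : K →+* ℂ, f.Admissible ι₁ ∧ ∃ (V : HermSpace3 K ι₁) (σ : K →+* ℂ),
        (Model.picardCMUniverse exists_isReal_hodgeModel_holds hodgePQ_independent_of_hodgeModel_holds
          BallQuotient.ballQuotientUniformised_holds cmAbelianVarietyRealised_holds).PeriodNV ι₁ V K f.psi σ) →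
      ∀ {P B : AbelianVariety ℂ}, AbelianVariety.IsProductOf (fun B : AbelianVariety ℂ =>
        ∃ (E : Type) (_ : Field E) (_ : NumberField E) (_ : IsCMField E) (_ : E →+* (K : Type)) (Φ : CMType E)
          (ι : 𝓞 E →+* End B) (ϑ : E →+* Module.End ℂ (complexBetti B.X 1)),
          IsCMTypeRealisation Φ B ι ϑ) P →
      AVDominatedBy B P → HodgeConjectureFor B.dim B.X) := by
  obtain ⟨⟨𝒮, hcard, hgen⟩, -⟩ := isLeast_card_faces_hgen_of_finrank_lt_sixtyFour (F := K) h64 h32 h48 σ₀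
  refine ⟨𝒮, hcard, fun h P B hP hB => ?_⟩
  exact hodgeConjectureFor_of_avDominatedBy_isProductOf_of_exists_facePeriod_on K h6 (𝒮 : Set (Face K)) σ₀ hgen
    (fun f hf => h f (Finset.mem_coe.mp hf)) hP hB

end Summit.HodgeConjecture.CorCM.FaceOrderSixteen

/-! ## §3 (appended, b23 gen 55) Every Galois CM field of degree `< 100` outside the six open degrees -/

namespace Summit.HodgeConjecture.CorCM.FaceOrderSixteen

open Summit.HodgeConjecture.CorCM.Prior.AllgGroup.RfwfAllgGroup
open Summit.HodgeConjecture.CorCM.Census.BlockParity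
open Summit.HodgeConjecture.CorCM.Census.Coinvariant
open Summit.HodgeConjecture.CorCM.Census

section Hundred

variable {F : Type} [Field F] [NumberField F]

/-- **EVERY GALOIS CM FIELD OF DEGREE `< 100` OTHER THAN `32, 48, 64, 72, 80, 96` HAS EXACTLY `φ₂(F)` GENERATING FACES** — no hypothesis on the
Galois group: `8 ∤ [F:ℚ]` by seat b23 gen 51ʼs Sylow-transfer law, `[F:ℚ] = 8` by gen 50, `16` by the order-16 dispatch, `24, 40, 56, 88 = 8p` by gen 53;
the six excluded degrees are exactly the open ones below `100` (`32, 64 = 2ᵏ`; `48, 80, 96 = 16·m`; `72 = 8·9`). [folklore] -/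
theorem isLeast_card_faces_hgen_of_finrank_lt_hundred [IsCMField F] [IsGalois ℚ F] (h100 : Module.finrank ℚ F < 100)
    (h32 : Module.finrank ℚ F ≠ 32) (h48 : Module.finrank ℚ F ≠ 48) (h64 : Module.finrank ℚ F ≠ 64) (h72 : Module.finrank ℚ F ≠ 72)
    (h80 : Module.finrank ℚ F ≠ 80) (h96 : Module.finrank ℚ F ≠ 96) (σ₀ : F →+* ℂ) :
    IsLeast {n : ℕ | ∃ 𝒮 : Finset (Face F), 𝒮.card = n ∧
      ∀ f : Face F, lefChar f.corner (fun _ => ({σ₀} : Finset (F →+* ℂ))) ∈ AddSubgroup.closure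
        {a : Asym F | ∃ g ∈ (𝒮 : Set (Face F)), ∃ σ : F →+* ℂ, a = lefChar g.corner (fun _ => ({σ} : Finset (F →+* ℂ)))}}
      (fibreTwo (conjT : GalT F) conjT_mul_self) := by
  by_cases h8 : 8 ∣ Module.finrank ℚ F
  · have hpos : 0 < Module.finrank ℚ F := Module.finrank_pos
    obtain ⟨m, hm⟩ := h8
    have hm13 : m < 13 := by omega
    have hcases : m = 1 ∨ m = 2 ∨ m = 3 ∨ m = 5 ∨ m = 7 ∨ m = 11 := by omega
    rcases hcases with rfl | rfl | rfl | rfl | rfl | rfl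
    · exact FaceIndexTwoCyclic.isLeast_card_faces_hgen_of_finrank_two_pow_le_eight (k := 3) (by rw [hm]; norm_num) le_rfl σ₀
    · exact isLeast_card_faces_hgen_of_finrank_eq_sixteen (by rw [hm]) σ₀
    · exact FaceBinaryTetrahedral.isLeast_card_faces_hgen_of_finrank_eq_twentyfour (by rw [hm]) σ₀
    · exact FaceBinaryTetrahedral.isLeast_card_faces_hgen_of_finrank_eq_eight_mul_odd_prime Nat.prime_five (by norm_num) hm σ₀
    · exact FaceBinaryTetrahedral.isLeast_card_faces_hgen_of_finrank_eq_eight_mul_odd_prime Nat.prime_seven (by norm_num) hm σ₀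
    · exact FaceBinaryTetrahedral.isLeast_card_faces_hgen_of_finrank_eq_eight_mul_odd_prime Nat.prime_eleven (by norm_num) hm σ₀
  · exact FaceSylowTransfer.isLeast_card_faces_hgen_of_not_eight_dvd_finrank h8 σ₀

end Hundred

/-- **HC for the slice of a Galois CM field of degree `6 ≤ [K:ℚ] < 100`, `[K:ℚ] ∉ {32, 48, 64, 72, 80, 96}`, from `φ₂(K)` face periods** (CONDITIONAL;
`HC_CM` is NOT proved; no hypothesis on the Galois group). [cite: Shimura1998, §6.2 Theorem 3 and §6.1 Corollary of Theorem 2 (pp. 41–43)]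
[cite: Pohlmann1968, Thm. 1] [cite: Milne1999LefschetzClasses, Thm. 3.2 and Cor. 4.5] [cite: MumfordAV1970, §19 Thm. 1 and p. 169] -/
theorem hodgeConjectureFor_of_finrank_lt_hundred_of_exists_facePeriod (K : CMField) [hGal : IsGalois ℚ K] (σ₀ : (K : Type) →+* ℂ)
    (h6 : 6 ≤ Module.finrank ℚ K) (h100 : Module.finrank ℚ K < 100) (h32 : Module.finrank ℚ K ≠ 32) (h48 : Module.finrank ℚ K ≠ 48)
    (h64 : Module.finrank ℚ K ≠ 64) (h72 : Module.finrank ℚ K ≠ 72) (h80 : Module.finrank ℚ K ≠ 80) (h96 : Module.finrank ℚ K ≠ 96) :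
    ∃ 𝒮 : Finset (Face K), 𝒮.card = fibreTwo (conjT : GalT K) conjT_mul_self ∧
      ((∀ f ∈ 𝒮, ∃ ι₁ : K →+* ℂ, f.Admissible ι₁ ∧ ∃ (V : HermSpace3 K ι₁) (σ : K →+* ℂ),
        (Model.picardCMUniverse exists_isReal_hodgeModel_holds hodgePQ_independent_of_hodgeModel_holds
          BallQuotient.ballQuotientUniformised_holds cmAbelianVarietyRealised_holds).PeriodNV ι₁ V K f.psi σ) →
      ∀ {P B : AbelianVariety ℂ}, AbelianVariety.IsProductOf (fun B : AbelianVariety ℂ =>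
        ∃ (E : Type) (_ : Field E) (_ : NumberField E) (_ : IsCMField E) (_ : E →+* (K : Type)) (Φ : CMType E)
          (ι : 𝓞 E →+* End B) (ϑ : E →+* Module.End ℂ (complexBetti B.X 1)),
          IsCMTypeRealisation Φ B ι ϑ) P →
      AVDominatedBy B P → HodgeConjectureFor B.dim B.X) := by
  obtain ⟨⟨𝒮, hcard, hgen⟩, -⟩ := isLeast_card_faces_hgen_of_finrank_lt_hundred (F := K) h100 h32 h48 h64 h72 h80 h96 σ₀
  refine ⟨𝒮, hcard, fun h P B hP hB => ?_⟩
  exact hodgeConjectureFor_of_avDominatedBy_isProductOf_of_exists_facePeriod_on K h6 (𝒮 : Set (Face K)) σ₀ hgen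
    (fun f hf => h f (Finset.mem_coe.mp hf)) hP hB

end Summit.HodgeConjecture.CorCM.FaceOrderSixteen
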